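import Literature.NumberTheory.Automorphic.MeyerThetaMellin
import Mathlib.Analysis.MellinTransform
import Mathlib.Analysis.SpecialFunctions.Pow.Deriv
import Mathlib.Analysis.SpecialFunctions.Complex.Analytic
import Mathlib.MeasureTheory.Integral.IntegralEqImproper
import Mathlib.Analysis.Calculus.IteratedDeriv.Lemmas
import HarnessLib

/-!
# Meyer's global difference representation — proofs, `K = ℚ`: test functions with compact support
# in `(0, ∞)` and the Mellin calculus `D_s`, `R_s` on them

Topic `NumberTheory/Automorphic`; namespace `Literature.NumberTheory.Automorphic.Meyer`. Sibling
PROOF file (real analysis, Mathlib + `MeyerThetaMellin`) for Step D of the plan for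
`Meyer.spectralRealisation_rat` [Meyer2005, Thm. 5.11].

The archimedean test functions fed into Meyer's summation map `Σ(G ⊗ 1_Ẑ)` [Meyer2005, §5.3, §5.7]
in our proof of the lower bound of Thm. 5.11 are smooth functions `G` on `ℝ` supported in a compact
interval `[c₁, c₂] ⊂ (0, ∞)` (`IsCompactTest`). For these the Mellin transform
`MG(z) = ∫₀^∞ G(t) t^{z-1} dt` is ENTIRE, `Σ(G ⊗ 1_Ẑ)[z(t)] = ∑_{n ≥ 1} G(nt)` has Mellin transform
`ζ(z) MG(z)` (`Re z > 1`), and the class is stable under the three operators whose Mellin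
multipliers generate the Jordan-chain bookkeeping of [Meyer2005, Thm. 5.11]:

* dilation `G(c ·)` — multiplier `c^{-z}`;
* `D_s G = -t G' - s G` — multiplier `z - s` (`mellin_Ds`);
* the multiplicative primitive `R_s G (t) = -t^{-s} ∫₀^t τ^{s-1} G(τ) dτ` — when `MG(s) = 0` this is
  again supported in `[c₁, c₂]` and `(z - s) M(R_s G) = MG` (`isCompactTest_mulPrimitive`,
  `mellin_mulPrimitive`).

No smoothness issue at `t = 0` ever arises: all functions vanish near `0`.

Everything is proved; the definitions are the predicate and the two operators.

## References

* R. Meyer, *On a representation of the idele class group related to primes and zeros of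
  L-functions*, Duke Math. J. 127 (2005) = arXiv:math/0311468, §5.7, Thm. 5.11 [Meyer2005].
-/

noncomputable section

open MeasureTheory Set Filter Complex
open scoped Topology ContDiff

namespace Literature.NumberTheory.Automorphic.Meyer

/-! ### A gluing lemma -/

/-- A function smooth on an open set `U` and vanishing on an open set `V` with `U ∪ V = ℝ` is
smooth. [folklore] -/
theorem contDiff_of_contDiffOn_of_eqOn_zero {f : ℝ → ℂ} {U V : Set ℝ} (hU : IsOpen U) (hV : IsOpen V)
    (hUV : ∀ x, x ∈ U ∨ x ∈ V) (hfU : ContDiffOn ℝ ∞ f U) (hfV : ∀ x ∈ V, f x = 0) : ContDiff ℝ ∞ f := by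
  rw [contDiff_iff_contDiffAt]
  intro x
  rcases hUV x with hx | hx
  · exact hfU.contDiffAt (hU.mem_nhds hx)
  · have h : f =ᶠ[𝓝 x] fun _ => (0 : ℂ) :=
      Filter.eventuallyEq_of_mem (hV.mem_nhds hx) fun y hy => hfV y hy
    exact (contDiffAt_const.congr_of_eventuallyEq h)

/-- `t ↦ (t : ℂ) ^ w` is smooth on `(0, ∞)`. [folklore] -/
theorem contDiffOn_ofReal_cpow_const (w : ℂ) : ContDiffOn ℝ ∞ (fun t : ℝ => (t : ℂ) ^ w) (Ioi 0) := by
  intro t ht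
  have ht' : (t : ℂ) ∈ slitPlane := Complex.ofReal_mem_slitPlane.2 ht
  have h1 : AnalyticAt ℂ (fun z : ℂ => z ^ w) (t : ℂ) := analyticAt_id.cpow analyticAt_const ht'
  have h2 : ContDiffAt ℝ ∞ (fun z : ℂ => z ^ w) (t : ℂ) := (h1.contDiffAt.restrict_scalars ℝ)
  exact (h2.comp t Complex.ofRealCLM.contDiff.contDiffAt).contDiffWithinAt

/-! ### Compactly supported test functions on `(0, ∞)` -/

/-- **Test functions with compact support in `(0, ∞)`**: smooth `G : ℝ → ℂ` vanishing on `(-∞, c₁]`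
and on `[c₂, ∞)` for some `0 < c₁`. [cite: Meyer2005, §5.7] -/
structure IsCompactTest (G : ℝ → ℂ) : Prop where
  contDiff : ContDiff ℝ ∞ G
  exists_support : ∃ c₁ c₂ : ℝ, 0 < c₁ ∧ (∀ t, t ≤ c₁ → G t = 0) ∧ ∀ t, c₂ ≤ t → G t = 0

namespace IsCompactTest

variable {G H : ℝ → ℂ}

/-- A compact test function vanishes on `(-∞, 0]`. [folklore] -/
theorem eq_zero_of_nonpos (h : IsCompactTest G) {t : ℝ} (ht : t ≤ 0) : G t = 0 := by
  obtain ⟨c₁, c₂, hc₁, h₁, -⟩ := h.exists_support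
  exact h₁ t (by linarith)

/-- The support is compact. [folklore] -/
theorem hasCompactSupport (h : IsCompactTest G) : HasCompactSupport G := by
  obtain ⟨c₁, c₂, hc₁, h₁, h₂⟩ := h.exists_support
  refine HasCompactSupport.of_support_subset_isCompact (isCompact_Icc (a := c₁) (b := c₂)) ?_
  intro t ht
  rw [Function.mem_support] at ht
  by_contra hmem
  rw [mem_Icc, not_and_or, not_le, not_le] at hmem
  rcases hmem with hlt | hlt
  · exact ht (h₁ t hlt.le)
  · exact ht (h₂ t hlt.le)

/-- `G` is continuous. [folklore] -/
theorem continuous (h : IsCompactTest G) : Continuous G := h.contDiff.continuous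

/-- `G` is integrable. [folklore] -/
theorem integrable (h : IsCompactTest G) : Integrable G :=
  h.continuous.integrable_of_hasCompactSupport h.hasCompactSupport

/-- **A compact test function is a Schwartz function.** [folklore] -/
def toSchwartz (h : IsCompactTest G) : SchwartzMap ℝ ℂ :=
  h.hasCompactSupport.toSchwartzMap h.contDiff

/-- Values of `toSchwartz`. [folklore] -/
@[simp]
theorem toSchwartz_apply (h : IsCompactTest G) (t : ℝ) : h.toSchwartz t = G t := rfl

/-- The underlying function of `toSchwartz`. [folklore] -/
theorem coe_toSchwartz (h : IsCompactTest G) : ⇑h.toSchwartz = G := rfl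

/-- The zero function. [folklore] -/
theorem zero : IsCompactTest (0 : ℝ → ℂ) :=
  ⟨contDiff_const, 1, 1, one_pos, fun _ _ => rfl, fun _ _ => rfl⟩

/-- Sums. [folklore] -/
theorem add (hG : IsCompactTest G) (hH : IsCompactTest H) : IsCompactTest (G + H) := by
  obtain ⟨c₁, c₂, hc₁, h₁, h₂⟩ := hG.exists_support
  obtain ⟨d₁, d₂, hd₁, k₁, k₂⟩ := hH.exists_support
  refine ⟨hG.contDiff.add hH.contDiff, min c₁ d₁, max c₂ d₂, lt_min hc₁ hd₁, fun t ht => ?_, fun t ht => ?_⟩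
  · simp [h₁ t (ht.trans (min_le_left _ _)), k₁ t (ht.trans (min_le_right _ _))]
  · simp [h₂ t ((le_max_left _ _).trans ht), k₂ t ((le_max_right _ _).trans ht)]

/-- Scalar multiples. [folklore] -/
theorem const_mul (hG : IsCompactTest G) (c : ℂ) : IsCompactTest (fun t => c * G t) := by
  obtain ⟨c₁, c₂, hc₁, h₁, h₂⟩ := hG.exists_support
  exact ⟨contDiff_const.mul hG.contDiff, c₁, c₂, hc₁, fun t ht => by simp [h₁ t ht],
    fun t ht => by simp [h₂ t ht]⟩

/-- Negatives. [folklore] -/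
theorem neg (hG : IsCompactTest G) : IsCompactTest (-G) := by
  have h := hG.const_mul (-1)
  have : (fun t => (-1 : ℂ) * G t) = -G := by funext t; simp
  rwa [this] at h

/-- Differences. [folklore] -/
theorem sub (hG : IsCompactTest G) (hH : IsCompactTest H) : IsCompactTest (G - H) := by
  rw [sub_eq_add_neg]; exact hG.add hH.neg

/-- Finite sums. [folklore] -/
theorem sum {ι : Type*} (S : Finset ι) {F : ι → ℝ → ℂ} (hF : ∀ i ∈ S, IsCompactTest (F i)) :
    IsCompactTest (fun t => ∑ i ∈ S, F i t) := by
  classical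
  induction S using Finset.induction_on with
  | empty =>
      simp only [Finset.sum_empty]
      exact zero
  | insert a S ha ih =>
      have h1 : IsCompactTest (F a) := hF a (Finset.mem_insert_self a S)
      have h2 : IsCompactTest (fun t => ∑ i ∈ S, F i t) := ih fun i hi => hF i (Finset.mem_insert_of_mem hi)
      have h := h1.add h2
      have heq : (F a + fun t => ∑ i ∈ S, F i t) = fun t => ∑ i ∈ insert a S, F i t := by
        funext t
        rw [Finset.sum_insert ha]
        rfl
      rwa [heq] at h

/-- **Dilations** `t ↦ G(ct)`, `c > 0`. [cite: Meyer2005, §3.1 (3.1)] -/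
theorem dilate (hG : IsCompactTest G) {c : ℝ} (hc : 0 < c) : IsCompactTest (fun t => G (c * t)) := by
  obtain ⟨c₁, c₂, hc₁, h₁, h₂⟩ := hG.exists_support
  refine ⟨hG.contDiff.comp (contDiff_const.mul contDiff_id), c₁ / c, c₂ / c, div_pos hc₁ hc,
    fun t ht => h₁ _ ?_, fun t ht => h₂ _ ?_⟩
  · rwa [le_div_iff₀ hc, mul_comm] at ht
  · rwa [div_le_iff₀ hc, mul_comm] at ht

/-! #### Mellin transforms of compact test functions -/

/-- The Mellin integral of a compact test function converges at every `z`. [folklore] -/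
theorem mellinConvergent (hG : IsCompactTest G) (z : ℂ) : MellinConvergent G z := by
  obtain ⟨c₁, c₂, hc₁, h₁, h₂⟩ := hG.exists_support
  refine mellinConvergent_of_isBigO_rpow (a := z.re + 1) (b := z.re - 1)
    (hG.continuous.locallyIntegrable.locallyIntegrableOn _) ?_ (by linarith) ?_ (by linarith)
  · refine Asymptotics.IsBigO.of_bound 0 ?_
    filter_upwards [eventually_ge_atTop c₂] with t ht
    simp [h₂ t ht]
  · refine Asymptotics.IsBigO.of_bound 0 ?_
    filter_upwards [Ioo_mem_nhdsGT hc₁] with t ht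
    simp [h₁ t ht.2.le]

/-- **The Mellin transform of a compact test function is entire.** [folklore] -/
theorem differentiableAt_mellin (hG : IsCompactTest G) (z : ℂ) : DifferentiableAt ℂ (mellin G) z := by
  obtain ⟨c₁, c₂, hc₁, h₁, h₂⟩ := hG.exists_support
  refine mellin_differentiableAt_of_isBigO_rpow (a := z.re + 1) (b := z.re - 1)
    (hG.continuous.locallyIntegrable.locallyIntegrableOn _) ?_ (by linarith) ?_ (by linarith)
  · refine Asymptotics.IsBigO.of_bound 0 ?_
    filter_upwards [eventually_ge_atTop c₂] with t ht
    simp [h₂ t ht]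
  · refine Asymptotics.IsBigO.of_bound 0 ?_
    filter_upwards [Ioo_mem_nhdsGT hc₁] with t ht
    simp [h₁ t ht.2.le]

/-- The Mellin transform of a compact test function is an entire function. [folklore] -/
theorem differentiable_mellin (hG : IsCompactTest G) : Differentiable ℂ (mellin G) :=
  fun z => hG.differentiableAt_mellin z

/-- **Dilation rule** `M(G(c·))(z) = c^{-z} MG(z)`. [folklore] -/
theorem mellin_dilate (G : ℝ → ℂ) {c : ℝ} (hc : 0 < c) (z : ℂ) :
    mellin (fun t => G (c * t)) z = (c : ℂ) ^ (-z) * mellin G z := by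
  rw [mellin_comp_mul_left G z hc, smul_eq_mul]

/-- `∫ G = MG(1)` for a function vanishing on `(-∞, 0]`. [folklore] -/
theorem integral_eq_mellin_one (hG : IsCompactTest G) : ∫ t : ℝ, G t = mellin G 1 := by
  rw [mellin, ← setIntegral_eq_integral_of_forall_compl_eq_zero (s := Ioi (0 : ℝ))]
  · refine setIntegral_congr_fun measurableSet_Ioi fun t _ => ?_
    rw [sub_self, cpow_zero, one_smul]
  · intro t ht
    exact hG.eq_zero_of_nonpos (not_lt.mp ht)

/-! #### The theta sum of a compact test function -/

/-- For `G` vanishing on `(-∞, 0]` and `t > 0`: `∑_{n ∈ ℤ, n ≠ 0} G(nt) = ∑_{n ≥ 1} G(nt)`.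
[cite: Meyer2005, §5.7] -/
theorem tsum_int_ite_eq_tsum_nat (hG : IsCompactTest G) {t : ℝ} (ht : 0 < t) :
    (∑' n : ℤ, if n = 0 then (0 : ℂ) else G (n * t)) = ∑' n : ℕ, G (((n + 1 : ℕ) : ℝ) * t) := by
  have hsum : Summable fun n : ℕ => G (((n + 1 : ℕ) : ℝ) * t) := by
    have h := summable_schwartz_comp_nat_mul hG.toSchwartz ht
    simpa only [toSchwartz_apply] using h
  set f : ℤ → ℂ := fun n => if n = 0 then (0 : ℂ) else G (n * t) with hf
  set S : ℂ := ∑' n : ℕ, G (((n + 1 : ℕ) : ℝ) * t)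
  have hnat : HasSum (fun n : ℕ => f n) S := by
    have h1 : HasSum (fun n : ℕ => f ((n + 1 : ℕ) : ℤ)) S := by
      have : (fun n : ℕ => f ((n + 1 : ℕ) : ℤ)) = fun n : ℕ => G (((n + 1 : ℕ) : ℝ) * t) := by
        funext n
        rw [hf]
        simp only [Nat.cast_add, Nat.cast_one]
        rw [if_neg (by positivity)]
        push_cast
        ring_nf
      rw [this]
      exact hsum.hasSum
    have h2 := (hasSum_nat_add_iff (f := fun n : ℕ => f n) 1).mp h1
    have hf0 : f 0 = 0 := by rw [hf]; simp
    simpa [Finset.sum_range_one, hf0] using h2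
  have hneg : HasSum (fun n : ℕ => f (-(n + 1 : ℤ))) 0 := by
    have : (fun n : ℕ => f (-(n + 1 : ℤ))) = fun _ => 0 := by
      funext n
      rw [hf]
      simp only
      rw [if_neg (by omega)]
      push_cast
      exact hG.eq_zero_of_nonpos (by nlinarith)
    rw [this]
    exact hasSum_zero
  have h := HasSum.of_nat_of_neg_add_one hnat hneg
  rw [add_zero] at h
  exact h.tsum_eq

/-- **Riemann's unfolding for a compact test function**: for `1 < Re z`,
`∫₀^∞ (∑_{n ≠ 0} G(nt)) t^{z-1} dt = ζ(z) MG(z)`. [cite: Meyer2005, §5.7] -/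
theorem mellin_theta (hG : IsCompactTest G) {z : ℂ} (hz : 1 < z.re) :
    mellin (fun t : ℝ => ∑' n : ℤ, if n = 0 then (0 : ℂ) else G (n * t)) z = riemannZeta z * mellin G z := by
  have h1 : mellin (fun t : ℝ => ∑' n : ℤ, if n = 0 then (0 : ℂ) else G (n * t)) z =
      mellin (fun t : ℝ => ∑' n : ℕ, hG.toSchwartz (((n + 1 : ℕ) : ℝ) * t)) z := by
    rw [mellin, mellin]
    refine setIntegral_congr_fun measurableSet_Ioi fun t ht => ?_
    simp only [toSchwartz_apply]
    rw [hG.tsum_int_ite_eq_tsum_nat ht]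
  rw [h1, mellin_tsum_comp_nat_mul hG.toSchwartz hz, coe_toSchwartz]

/-! #### Derivatives and the operator `D_s = -t d/dt - s` -/

/-- The derivative of a compact test function is a compact test function. [folklore] -/
theorem deriv (hG : IsCompactTest G) : IsCompactTest (_root_.deriv G) := by
  obtain ⟨c₁, c₂, hc₁, h₁, h₂⟩ := hG.exists_support
  refine ⟨(contDiff_infty_iff_deriv.mp hG.contDiff).2, c₁ / 2, c₂ + 1, by positivity,
    fun t ht => ?_, fun t ht => ?_⟩
  · have h : G =ᶠ[𝓝 t] fun _ => (0 : ℂ) :=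
      Filter.eventuallyEq_of_mem (Iio_mem_nhds (show t < c₁ by linarith)) fun y hy => h₁ y (le_of_lt hy)
    rw [h.deriv_eq, deriv_const]
  · have h : G =ᶠ[𝓝 t] fun _ => (0 : ℂ) :=
      Filter.eventuallyEq_of_mem (Ioi_mem_nhds (show c₂ < t by linarith)) fun y hy => h₂ y (le_of_lt hy)
    rw [h.deriv_eq, deriv_const]

/-- Multiplication by `t`. [folklore] -/
theorem ofReal_mul (hG : IsCompactTest G) : IsCompactTest (fun t => (t : ℂ) * G t) := by
  obtain ⟨c₁, c₂, hc₁, h₁, h₂⟩ := hG.exists_support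
  exact ⟨Complex.ofRealCLM.contDiff.mul hG.contDiff, c₁, c₂, hc₁, fun t ht => by simp [h₁ t ht],
    fun t ht => by simp [h₂ t ht]⟩

end IsCompactTest

/-- **The operator `D_s G = -t G' - s G`** (Mellin multiplier `z - s`). [cite: Meyer2005, Thm. 5.11] -/
def Ds (s : ℂ) (G : ℝ → ℂ) (t : ℝ) : ℂ :=
  -(t : ℂ) * deriv G t - s * G t

/-- `D_s` preserves compact test functions. [folklore] -/
theorem isCompactTest_Ds {G : ℝ → ℂ} (hG : IsCompactTest G) (s : ℂ) : IsCompactTest (Ds s G) := by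
  have h := (hG.deriv.ofReal_mul.neg).add (hG.const_mul (-s))
  have heq : (-(fun t : ℝ => (t : ℂ) * deriv G t) + fun t : ℝ => -s * G t) = Ds s G := by
    funext t
    simp only [Pi.add_apply, Pi.neg_apply, Ds]
    ring
  rwa [heq] at h

/-- Integrability on `(0, ∞)` of `u · K` for `u` continuous on `(0, ∞)` and `K` a compact test
function. [folklore] -/
theorem IsCompactTest.integrableOn_Ioi_mul {K : ℝ → ℂ} (hK : IsCompactTest K) {u : ℝ → ℂ}
    (hu : ContinuousOn u (Ioi 0)) : IntegrableOn (fun t => u t * K t) (Ioi 0) := by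
  obtain ⟨c₁, c₂, hc₁, h₁, h₂⟩ := hK.exists_support
  have hIcc : IntegrableOn (fun t => u t * K t) (Icc c₁ c₂) := by
    refine ContinuousOn.integrableOn_compact isCompact_Icc ?_
    exact (hu.mono fun t ht => lt_of_lt_of_le hc₁ ht.1).mul hK.continuous.continuousOn
  refine hIcc.of_forall_sdiff_eq_zero measurableSet_Ioi fun t ht => ?_
  rw [Set.mem_sdiff, mem_Icc, not_and_or, not_le, not_le] at ht
  rcases ht.2 with h | h
  · rw [h₁ t h.le, mul_zero]
  · rw [h₂ t h.le, mul_zero]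

/-- **`M(t G')(z) = -z MG(z)`** (integration by parts on `(0, ∞)`; no boundary terms).
[folklore] -/
theorem IsCompactTest.mellin_ofReal_mul_deriv {G : ℝ → ℂ} (hG : IsCompactTest G) (z : ℂ) :
    mellin (fun t => (t : ℂ) * _root_.deriv G t) z = -z * mellin G z := by
  obtain ⟨c₁, c₂, hc₁, h₁, h₂⟩ := hG.exists_support
  have hucont : ContinuousOn (fun t : ℝ => (t : ℂ) ^ z) (Ioi 0) := (contDiffOn_ofReal_cpow_const z).continuousOn
  have hu'cont : ContinuousOn (fun t : ℝ => z * (t : ℂ) ^ (z - 1)) (Ioi 0) :=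
    continuousOn_const.mul (contDiffOn_ofReal_cpow_const (z - 1)).continuousOn
  have hu : ∀ x ∈ Ioi (0 : ℝ), HasDerivAt (fun t : ℝ => (t : ℂ) ^ z) (z * (x : ℂ) ^ (z - 1)) x :=
    fun x hx => (Complex.hasStrictDerivAt_cpow_const (Complex.ofReal_mem_slitPlane.2 hx)).hasDerivAt.comp_ofReal
  have hv : ∀ x ∈ Ioi (0 : ℝ), HasDerivAt G (_root_.deriv G x) x :=
    fun x _ => ((hG.contDiff.differentiable (by simp)).differentiableAt).hasDerivAt
  have huv' : IntegrableOn ((fun t : ℝ => (t : ℂ) ^ z) * _root_.deriv G) (Ioi 0) :=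
    hG.deriv.integrableOn_Ioi_mul hucont
  have hu'v : IntegrableOn ((fun t : ℝ => z * (t : ℂ) ^ (z - 1)) * G) (Ioi 0) :=
    hG.integrableOn_Ioi_mul hu'cont
  have h_zero : Tendsto ((fun t : ℝ => (t : ℂ) ^ z) * G) (𝓝[>] 0) (𝓝 0) := by
    refine tendsto_const_nhds.congr' ?_
    filter_upwards [Ioo_mem_nhdsGT hc₁] with t ht
    simp [h₁ t ht.2.le]
  have h_infty : Tendsto ((fun t : ℝ => (t : ℂ) ^ z) * G) atTop (𝓝 0) := by
    refine tendsto_const_nhds.congr' ?_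
    filter_upwards [eventually_ge_atTop c₂] with t ht
    simp [h₂ t ht]
  have h := integral_Ioi_mul_deriv_eq_deriv_mul hu hv huv' hu'v h_zero h_infty
  simp only [sub_zero, zero_sub] at h
  -- `h : ∫ t^z G' = -∫ z t^{z-1} G`
  have hl : mellin (fun t => (t : ℂ) * _root_.deriv G t) z = ∫ t in Ioi (0 : ℝ), (t : ℂ) ^ z * _root_.deriv G t := by
    rw [mellin]
    refine setIntegral_congr_fun measurableSet_Ioi fun t ht => ?_
    have ht0 : (t : ℂ) ≠ 0 := Complex.ofReal_ne_zero.mpr (ne_of_gt ht)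
    rw [smul_eq_mul, ← mul_assoc, Complex.cpow_sub _ _ ht0, Complex.cpow_one, div_mul_cancel₀ _ ht0]
  have hr : (∫ t in Ioi (0 : ℝ), z * (t : ℂ) ^ (z - 1) * G t) = z * mellin G z := by
    rw [mellin, ← integral_const_mul]
    refine setIntegral_congr_fun measurableSet_Ioi fun t _ => ?_
    rw [smul_eq_mul, mul_assoc]
  rw [hl, h, hr]
  ring

/-- **`M(D_s G)(z) = (z - s) MG(z)`.** [cite: Meyer2005, Thm. 5.11] -/
theorem IsCompactTest.mellin_Ds {G : ℝ → ℂ} (hG : IsCompactTest G) (s z : ℂ) :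
    mellin (Ds s G) z = (z - s) * mellin G z := by
  have h1 : MellinConvergent (fun t => (t : ℂ) * _root_.deriv G t) z := hG.deriv.ofReal_mul.mellinConvergent z
  have h2 : MellinConvergent G z := hG.mellinConvergent z
  have hsplit : mellin (Ds s G) z = -mellin (fun t => (t : ℂ) * _root_.deriv G t) z - s * mellin G z := by
    rw [mellin, mellin, mellin, ← integral_neg, ← integral_const_mul, ← integral_sub]
    · refine setIntegral_congr_fun measurableSet_Ioi fun t _ => ?_
      simp only [Ds, smul_eq_mul]
      ring
    · exact h1.neg
    · exact h2.const_mul s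
  rw [hsplit, hG.mellin_ofReal_mul_deriv z]
  ring

/-! ### The multiplicative primitive `R_s` -/

/-- **The multiplicative primitive** `R_s G (t) = -t^{-s} ∫₀^t τ^{s-1} G(τ) dτ`.
[cite: Meyer2005, Thm. 5.11] -/
def mulPrimitive (s : ℂ) (G : ℝ → ℂ) (t : ℝ) : ℂ :=
  -(t : ℂ) ^ (-s) * ∫ τ in (0 : ℝ)..t, (τ : ℂ) ^ (s - 1) * G τ

section MulPrimitive

variable {G : ℝ → ℂ} (s : ℂ)

/-- The integrand `τ^{s-1} G(τ)` is smooth on `ℝ` (it vanishes near `τ ≤ 0`). [folklore] -/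
theorem contDiff_cpow_mul (hG : IsCompactTest G) : ContDiff ℝ ∞ fun τ : ℝ => (τ : ℂ) ^ (s - 1) * G τ := by
  obtain ⟨c₁, c₂, hc₁, h₁, h₂⟩ := hG.exists_support
  refine contDiff_of_contDiffOn_of_eqOn_zero isOpen_Ioi isOpen_Iio (U := Ioi 0) (V := Iio c₁)
    (fun x => ?_) ((contDiffOn_ofReal_cpow_const (s - 1)).mul hG.contDiff.contDiffOn) fun x hx => ?_
  · by_cases hx : 0 < x
    · exact Or.inl hx
    · exact Or.inr (lt_of_le_of_lt (not_lt.mp hx) hc₁)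
  · rw [h₁ x (le_of_lt hx), mul_zero]

/-- The integrand vanishes on `(-∞, c₁]` and on `[c₂, ∞)`. [folklore] -/
theorem isCompactTest_cpow_mul (hG : IsCompactTest G) : IsCompactTest fun τ : ℝ => (τ : ℂ) ^ (s - 1) * G τ := by
  obtain ⟨c₁, c₂, hc₁, h₁, h₂⟩ := hG.exists_support
  exact ⟨contDiff_cpow_mul s hG, c₁, c₂, hc₁, fun t ht => by simp [h₁ t ht], fun t ht => by simp [h₂ t ht]⟩

/-- The partial Mellin integral `F(t) = ∫₀^t τ^{s-1} G(τ) dτ` has derivative `t^{s-1} G(t)`.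
[folklore] -/
theorem hasDerivAt_partialMellin (hG : IsCompactTest G) (t : ℝ) :
    HasDerivAt (fun u : ℝ => ∫ τ in (0 : ℝ)..u, (τ : ℂ) ^ (s - 1) * G τ) ((t : ℂ) ^ (s - 1) * G t) t := by
  have hcont : Continuous fun τ : ℝ => (τ : ℂ) ^ (s - 1) * G τ := (contDiff_cpow_mul s hG).continuous
  exact intervalIntegral.integral_hasDerivAt_right (hcont.intervalIntegrable _ _)
    (hcont.stronglyMeasurableAtFilter _ _) hcont.continuousAt

/-- The partial Mellin integral is smooth. [folklore] -/
theorem contDiff_partialMellin (hG : IsCompactTest G) :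
    ContDiff ℝ ∞ fun u : ℝ => ∫ τ in (0 : ℝ)..u, (τ : ℂ) ^ (s - 1) * G τ := by
  rw [contDiff_infty_iff_deriv]
  refine ⟨fun t => (hasDerivAt_partialMellin s hG t).differentiableAt, ?_⟩
  have : _root_.deriv (fun u : ℝ => ∫ τ in (0 : ℝ)..u, (τ : ℂ) ^ (s - 1) * G τ) =
      fun t : ℝ => (t : ℂ) ^ (s - 1) * G t := funext fun t => (hasDerivAt_partialMellin s hG t).deriv
  rw [this]
  exact contDiff_cpow_mul s hG

/-- The partial Mellin integral vanishes on `(-∞, c₁]` if `G` does. [folklore] -/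
theorem partialMellin_eq_zero_of_le {c₁ : ℝ} (hc₁ : 0 < c₁) (h₁ : ∀ t, t ≤ c₁ → G t = 0) {t : ℝ}
    (ht : t ≤ c₁) : (∫ τ in (0 : ℝ)..t, (τ : ℂ) ^ (s - 1) * G τ) = 0 := by
  refine intervalIntegral.integral_zero_ae (Eventually.of_forall fun τ hτ => ?_)
  have hτ' : τ ≤ c₁ := by
    rcases le_total 0 t with h0t | ht0
    · rw [uIoc_of_le h0t] at hτ; exact hτ.2.trans ht
    · rw [uIoc_of_ge ht0] at hτ; exact hτ.2.trans hc₁.le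
  rw [h₁ τ hτ', mul_zero]

/-- The partial Mellin integral equals `MG(s)` on `[c₂, ∞)`. [folklore] -/
theorem partialMellin_eq_mellin_of_ge {c₂ : ℝ} (h₂ : ∀ t, c₂ ≤ t → G t = 0)
    {t : ℝ} (ht : c₂ ≤ t) (ht0 : 0 ≤ t) : (∫ τ in (0 : ℝ)..t, (τ : ℂ) ^ (s - 1) * G τ) = mellin G s := by
  rw [intervalIntegral.integral_of_le ht0, mellin]
  have hmul : (∫ τ in Ioi (0 : ℝ), (τ : ℂ) ^ (s - 1) • G τ) = ∫ τ in Ioi (0 : ℝ), (τ : ℂ) ^ (s - 1) * G τ :=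
    setIntegral_congr_fun measurableSet_Ioi fun τ _ => by rw [smul_eq_mul]
  rw [hmul, setIntegral_eq_of_subset_of_forall_sdiff_eq_zero measurableSet_Ioi Ioc_subset_Ioi_self]
  intro τ hτ
  rw [Set.mem_sdiff, mem_Ioc, not_and, not_le] at hτ
  have hτ0 : 0 < τ := hτ.1
  rw [h₂ τ (ht.trans (hτ.2 hτ0).le), mul_zero]

/-- `R_s G` vanishes on `(-∞, c₁]`. [folklore] -/
theorem mulPrimitive_eq_zero_of_le {c₁ : ℝ} (hc₁ : 0 < c₁) (h₁ : ∀ t, t ≤ c₁ → G t = 0) {t : ℝ}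
    (ht : t ≤ c₁) : mulPrimitive s G t = 0 := by
  rw [mulPrimitive, partialMellin_eq_zero_of_le s hc₁ h₁ ht, mul_zero]

/-- **`R_s G` is smooth.** [folklore] -/
theorem contDiff_mulPrimitive (hG : IsCompactTest G) : ContDiff ℝ ∞ (mulPrimitive s G) := by
  obtain ⟨c₁, c₂, hc₁, h₁, h₂⟩ := hG.exists_support
  refine contDiff_of_contDiffOn_of_eqOn_zero isOpen_Ioi isOpen_Iio (U := Ioi 0) (V := Iio c₁)
    (fun x => ?_) ?_ fun x hx => mulPrimitive_eq_zero_of_le s hc₁ h₁ hx.le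
  · by_cases hx : 0 < x
    · exact Or.inl hx
    · exact Or.inr (lt_of_le_of_lt (not_lt.mp hx) hc₁)
  · exact ((contDiffOn_ofReal_cpow_const (-s)).neg).mul (contDiff_partialMellin s hG).contDiffOn

/-- **`R_s` preserves compact test functions when `MG(s) = 0`.** [cite: Meyer2005, Thm. 5.11] -/
theorem isCompactTest_mulPrimitive (hG : IsCompactTest G) (hs : mellin G s = 0) :
    IsCompactTest (mulPrimitive s G) := by
  obtain ⟨c₁, c₂, hc₁, h₁, h₂⟩ := hG.exists_support
  refine ⟨contDiff_mulPrimitive s hG, c₁, max c₂ 0, hc₁, fun t ht => mulPrimitive_eq_zero_of_le s hc₁ h₁ ht,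
    fun t ht => ?_⟩
  rw [mulPrimitive, partialMellin_eq_mellin_of_ge s h₂ ((le_max_left _ _).trans ht) ((le_max_right _ _).trans ht),
    hs, mul_zero]

/-- **`D_s (R_s G) = G`** pointwise. [cite: Meyer2005, Thm. 5.11] -/
theorem Ds_mulPrimitive (hG : IsCompactTest G) : Ds s (mulPrimitive s G) = G := by
  obtain ⟨c₁, c₂, hc₁, h₁, h₂⟩ := hG.exists_support
  funext t
  by_cases ht : 0 < t
  · -- calculus on `(0, ∞)`
    have ht0 : (t : ℂ) ≠ 0 := Complex.ofReal_ne_zero.mpr ht.ne'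
    have hsl : (t : ℂ) ∈ slitPlane := Complex.ofReal_mem_slitPlane.2 ht
    set F : ℝ → ℂ := fun u => ∫ τ in (0 : ℝ)..u, (τ : ℂ) ^ (s - 1) * G τ with hF
    have hu : HasDerivAt (fun u : ℝ => -(u : ℂ) ^ (-s)) (-(-s * (t : ℂ) ^ (-s - 1))) t :=
      ((Complex.hasStrictDerivAt_cpow_const hsl).hasDerivAt.comp_ofReal).neg
    have hFd : HasDerivAt F ((t : ℂ) ^ (s - 1) * G t) t := hasDerivAt_partialMellin s hG t
    have hR : HasDerivAt (mulPrimitive s G)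
        (-(-s * (t : ℂ) ^ (-s - 1)) * F t + -(t : ℂ) ^ (-s) * ((t : ℂ) ^ (s - 1) * G t)) t := by
      have h := hu.mul hFd
      exact h
    rw [Ds, hR.deriv, mulPrimitive]
    change -(t : ℂ) * (-(-s * (t : ℂ) ^ (-s - 1)) * F t + -(t : ℂ) ^ (-s) * ((t : ℂ) ^ (s - 1) * G t)) -
        s * (-(t : ℂ) ^ (-s) * F t) = G t
    have e1 : (t : ℂ) * (t : ℂ) ^ (-s - 1) = (t : ℂ) ^ (-s) := by
      rw [Complex.cpow_sub _ _ ht0, Complex.cpow_one, mul_div_cancel₀ _ ht0]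
    have e2 : (t : ℂ) * ((t : ℂ) ^ (-s) * (t : ℂ) ^ (s - 1)) = 1 := by
      rw [← Complex.cpow_add _ _ ht0, show -s + (s - 1) = -1 by ring, Complex.cpow_neg_one, mul_inv_cancel₀ ht0]
    linear_combination (-(s * F t)) * e1 + (G t) * e2
  · -- both sides vanish near `t ≤ 0 < c₁`
    have ht' : t < c₁ := lt_of_le_of_lt (not_lt.mp ht) hc₁
    have hRz : mulPrimitive s G =ᶠ[𝓝 t] fun _ => (0 : ℂ) :=
      Filter.eventuallyEq_of_mem (Iio_mem_nhds ht') fun y hy => mulPrimitive_eq_zero_of_le s hc₁ h₁ hy.le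
    rw [Ds, hRz.deriv_eq, deriv_const, mulPrimitive_eq_zero_of_le s hc₁ h₁ ht'.le, h₁ t ht'.le]
    simp

/-- **`R_s` divides the Mellin transform by `z - s`**: `(z - s) M(R_s G)(z) = MG(z)` when
`MG(s) = 0`. [cite: Meyer2005, Thm. 5.11] -/
theorem mellin_mulPrimitive (hG : IsCompactTest G) (hs : mellin G s = 0) (z : ℂ) :
    (z - s) * mellin (mulPrimitive s G) z = mellin G z := by
  rw [← (isCompactTest_mulPrimitive s hG hs).mellin_Ds s z, Ds_mulPrimitive s hG]

end MulPrimitive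

end Literature.NumberTheory.Automorphic.Meyer
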